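import Mathlib.NumberTheory.Chebyshev
import Mathlib.NumberTheory.ArithmeticFunction.Misc
import Mathlib.Data.Nat.Choose.Sum
import Mathlib.Data.Nat.Choose.Bounds
import Mathlib.Analysis.Complex.ExponentialBounds
import Literature.NumberTheory.LFunctions.ChebyshevSylvesterPsi
import HarnessLib

/-!
# Stub `stub_helsonG` of crux `WeilComb.CombShapePositivity` (item stmt-RiemannHypothesis-11229,
route route-RiemannHypothesis-WeilComb) — by generating-function manipulation

The Helson potential bound: for every `M` and `a : ℕ → ℂ`,

`Σ_{m ≤ M} ‖a_m‖² (log m + ψ₁(M/m)) ≤ (log M + 39/50) Σ_{m ≤ M} ‖a_m‖²`,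
`ψ₁(N) = Σ_{n ≤ N} Λ(n)/n`.

This file gives a self-contained, fully elementary proof with the better constant
`log 4 − 1 = 0.3862… ≤ 39/50`, driven by ONE identity of Dirichlet generating functions,
`Λ * ζ = log` (i.e. `−ζ'/ζ · ζ = −ζ'`), in its summed form

`T(N) := Σ_{m ≤ N} log m = log N! = Σ_{k ≤ N} Λ(k) ⌊N/k⌋`   (Mathlib's
`ArithmeticFunction.vonMangoldt_mul_zeta` + `sum_Ioc_mul_zeta_eq_sum`, packaged in the tree as
`Literature.NumberTheory.LFunctions.Sylvester.T_eq_sum`).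

The identity is used twice.

1. **Chebyshev, sharp at the origin: `ψ(N) ≤ (N − 1) log 4` for every `N ≥ 1`.** For `N = a + b`,
   `a ≤ b`, the coefficient extraction
   `log C(N, a) = T(N) − T(a) − T(b) = Σ_{k ≤ N} Λ(k) (⌊N/k⌋ − ⌊a/k⌋ − ⌊b/k⌋)`
   has all coefficients `≥ 0` and coefficient `1` at every `k ∈ (b, N]`, so
   `ψ(N) − ψ(b) ≤ log C(N, a)`; with `a = ⌊N/2⌋` one has `C(N, ⌊N/2⌋) ≤ 4^{⌊N/2⌋}`
   (`Nat.choose_le_two_pow` for even `N`, `Nat.choose_middle_le_pow` for odd `N`), hence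
   `ψ(N) ≤ ψ(N − ⌊N/2⌋) + ⌊N/2⌋ log 4` and, by strong induction from `ψ(1) = 0`,
   `ψ(N) ≤ (N − ⌊N/2⌋ − 1 + ⌊N/2⌋) log 4 = (N − 1) log 4`.
2. **`N ψ₁(N) ≤ T(N) − log N + ψ(N)`**: `N/k = ⌊N/k⌋ + {N/k}` with `{N/k} < 1`, and `{N/k} = 0`
   when `k ∣ N`; the divisors of `N` carry `Σ_{k ∣ N} Λ(k) = log N` (`vonMangoldt_sum`, the same
   identity again), so `Σ_k Λ(k) {N/k} ≤ ψ(N) − log N`.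

With the weak Stirling bound `T(N) ≤ N log N − N + 1 + log N` (`Sylvester.T_le`) this gives
`N ψ₁(N) ≤ N log N − N + 1 + (N − 1) log 4 = N (log N + log 4 − 1) − (log 4 − 1)`, i.e.

`ψ₁(N) ≤ log N + log 4 − 1 < log N + 0.3863` for all `N ≥ 1`

(asymptotically `ψ₁(N) = log N − γ + o(1)`), and the row bound
`log m + ψ₁(⌊M/m⌋) ≤ log (m ⌊M/m⌋) + log 4 − 1 ≤ log M + 39/50` for `1 ≤ m ≤ M`; multiplying by
`‖a_m‖² ≥ 0` and summing gives the stub. No Rosser–Schoenfeld input and no numerical table is used;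
the only numerics are Mathlib's `log 2 < 0.6931471808`.

References: P. L. Chebyshev, *Mémoire sur les nombres premiers* (1852) (the binomial-coefficient
bound); F. Mertens, J. reine angew. Math. 78 (1874) (`Σ Λ(n)/n = log x + O(1)`); exposition
Hardy–Wright §22.6, Thms 424–425.
-/

noncomputable section

-- the sub-problem path `RiemannHypothesis/RiemannHypothesis` (single-conjunct summit, D-0017)
-- duplicates a namespace
set_option linter.dupNamespace false

namespace Summit.RiemannHypothesis.RiemannHypothesis.Theorems.WeilCombHelsonGGenFun

open Finset
open ArithmeticFunction hiding log id
open scoped Chebyshev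
open Literature.NumberTheory.LFunctions

/-! ### The generating-function identity `T(N) = log N! = Σ_{k ≤ N} Λ(k) ⌊N/k⌋` and its shifts -/

/-- `ψ(N) = Σ_{0 < k ≤ N} Λ(k)` at a natural number `N` (Mathlib's `Chebyshev.psi`). [folklore] -/
theorem psi_natCast (N : ℕ) : ψ (N : ℝ) = ∑ k ∈ Ioc 0 N, Λ k := by
  rw [Chebyshev.psi, Nat.floor_natCast]

/-- `T(N) = Σ_{m ≤ N} log m = log N!`. [folklore] -/
theorem T_eq_log_factorial (N : ℕ) : Sylvester.T N = Real.log ((Nat.factorial N : ℕ) : ℝ) := by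
  induction N with
  | zero => simp [Sylvester.T]
  | succ n ih =>
    rw [Sylvester.T_succ, ih, Nat.factorial_succ, Nat.cast_mul,
      Real.log_mul (by positivity) (by positivity)]
    push_cast
    ring

/-- The shifted generating-function identity: for `a ≤ N`,
`T(a) = Σ_{k ≤ N} Λ(k) ⌊a/k⌋` (the terms with `a < k ≤ N` vanish). [folklore] -/
theorem T_eq_sum_of_le {a N : ℕ} (h : a ≤ N) :
    Sylvester.T a = ∑ k ∈ Ioc 0 N, Λ k * ((a / k : ℕ) : ℝ) := by
  rw [Sylvester.T_eq_sum]
  refine Finset.sum_subset (fun k hk => ?_) (fun k hk hk' => ?_)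
  · simp only [mem_Ioc] at hk ⊢
    exact ⟨hk.1, hk.2.trans h⟩
  · simp only [mem_Ioc, not_and, not_le] at hk hk'
    rw [Nat.div_eq_of_lt (hk' hk.1), Nat.cast_zero, mul_zero]

/-- **Coefficient extraction for the binomial coefficient.** For `N = a + b`,
`log C(N, a) = T(N) − T(a) − T(b) = Σ_{k ≤ N} Λ(k) (⌊N/k⌋ − ⌊a/k⌋ − ⌊b/k⌋)`. [folklore] -/
theorem log_choose_eq_sum (a b : ℕ) :
    Real.log ((a + b).choose a : ℝ) =
      ∑ k ∈ Ioc 0 (a + b), Λ k * (((a + b) / k : ℕ) - (a / k : ℕ) - (b / k : ℕ) : ℝ) := by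
  have hc : (0 : ℝ) < ((a + b).choose a : ℝ) := by
    exact_mod_cast Nat.choose_pos (Nat.le_add_right a b)
  have hfac : ((a + b).choose a : ℝ) * ((Nat.factorial a : ℕ) : ℝ) * ((Nat.factorial b : ℕ) : ℝ) =
      ((Nat.factorial (a + b) : ℕ) : ℝ) := by
    have h := Nat.choose_mul_factorial_mul_factorial (Nat.le_add_right a b)
    rw [Nat.add_sub_cancel_left] at h
    exact_mod_cast h
  have hlog : Real.log ((a + b).choose a : ℝ) + Real.log ((Nat.factorial a : ℕ) : ℝ) +
      Real.log ((Nat.factorial b : ℕ) : ℝ) = Real.log ((Nat.factorial (a + b) : ℕ) : ℝ) := by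
    rw [← Real.log_mul hc.ne' (by positivity), ← Real.log_mul (by positivity) (by positivity), hfac]
  simp only [mul_sub, Finset.sum_sub_distrib]
  rw [← Sylvester.T_eq_sum, ← T_eq_sum_of_le (Nat.le_add_right a b),
    ← T_eq_sum_of_le (Nat.le_add_left b a), T_eq_log_factorial, T_eq_log_factorial,
    T_eq_log_factorial]
  linarith

/-! ### Chebyshev's bound `ψ(N) ≤ (N − 1) log 4` -/

/-- `ψ(a + b) − ψ(b) ≤ log C(a + b, a)` for `a ≤ b`: in the coefficient extraction
`log C(a+b, a) = Σ_k Λ(k) (⌊(a+b)/k⌋ − ⌊a/k⌋ − ⌊b/k⌋)` every coefficient is `≥ 0`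
(`⌊a/k⌋ + ⌊b/k⌋ ≤ ⌊(a+b)/k⌋`) and equals `1` for `b < k ≤ a + b`. [folklore] -/
theorem psi_add_sub_psi_le_log_choose {a b : ℕ} (hab : a ≤ b) :
    ψ ((a + b : ℕ) : ℝ) - ψ (b : ℝ) ≤ Real.log ((a + b).choose a : ℝ) := by
  rw [log_choose_eq_sum, psi_natCast, psi_natCast]
  have hsub : Ioc 0 b ⊆ Ioc 0 (a + b) := fun k hk => by
    simp only [mem_Ioc] at hk ⊢
    exact ⟨hk.1, hk.2.trans (Nat.le_add_left b a)⟩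
  have hsplit : ∑ k ∈ Ioc 0 (a + b) \ Ioc 0 b, Λ k + ∑ k ∈ Ioc 0 b, Λ k =
      ∑ k ∈ Ioc 0 (a + b), Λ k := Finset.sum_sdiff hsub
  have hmain : ∑ k ∈ Ioc 0 (a + b) \ Ioc 0 b, Λ k ≤
      ∑ k ∈ Ioc 0 (a + b), Λ k * (((a + b) / k : ℕ) - (a / k : ℕ) - (b / k : ℕ) : ℝ) := by
    calc ∑ k ∈ Ioc 0 (a + b) \ Ioc 0 b, Λ k
        = ∑ k ∈ Ioc 0 (a + b) \ Ioc 0 b,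
            Λ k * (((a + b) / k : ℕ) - (a / k : ℕ) - (b / k : ℕ) : ℝ) := by
          refine Finset.sum_congr rfl fun k hk => ?_
          simp only [mem_sdiff, mem_Ioc, not_and, not_le] at hk
          have hk0 : 0 < k := hk.1.1
          have hbk : b < k := hk.2 hk0
          have hak : a < k := lt_of_le_of_lt hab hbk
          have h1 : (a + b) / k = 1 := by
            have h2 : 0 < (a + b) / k := Nat.div_pos hk.1.2 hk0
            have h3 : (a + b) / k < 2 := (Nat.div_lt_iff_lt_mul hk0).2 (by omega)
            omega
          rw [h1, Nat.div_eq_of_lt hak, Nat.div_eq_of_lt hbk]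
          simp
      _ ≤ ∑ k ∈ Ioc 0 (a + b), Λ k * (((a + b) / k : ℕ) - (a / k : ℕ) - (b / k : ℕ) : ℝ) := by
          refine Finset.sum_le_sum_of_subset_of_nonneg Finset.sdiff_subset fun k _ _ => ?_
          refine mul_nonneg vonMangoldt_nonneg ?_
          have h := Nat.add_div_le_add_div a b k
          have h' : ((a / k : ℕ) : ℝ) + ((b / k : ℕ) : ℝ) ≤ (((a + b) / k : ℕ) : ℝ) := by
            exact_mod_cast h
          linarith
  linarith

/-- `log C(N, ⌊N/2⌋) ≤ ⌊N/2⌋ log 4` (`C(2n, n) ≤ 2^{2n}`, `C(2n+1, n) ≤ 4ⁿ`). [folklore] -/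
theorem log_choose_half_le (N : ℕ) :
    Real.log (N.choose (N / 2) : ℝ) ≤ ((N / 2 : ℕ) : ℝ) * Real.log 4 := by
  have hc : N.choose (N / 2) ≤ 4 ^ (N / 2) := by
    rcases Nat.even_or_odd N with ⟨n, hn⟩ | ⟨n, hn⟩
    · have hN : N / 2 = n := by omega
      rw [hN]
      calc N.choose n ≤ 2 ^ N := Nat.choose_le_two_pow N n
        _ = 4 ^ n := by rw [show N = 2 * n by omega, pow_mul]; norm_num
    · have hN : N / 2 = n := by omega
      rw [hN, hn]
      exact Nat.choose_middle_le_pow n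
  have hpos : (0 : ℝ) < (N.choose (N / 2) : ℝ) := by
    exact_mod_cast Nat.choose_pos (Nat.div_le_self N 2)
  calc Real.log (N.choose (N / 2) : ℝ) ≤ Real.log ((4 : ℝ) ^ (N / 2)) := by
        refine Real.log_le_log hpos ?_
        exact_mod_cast hc
    _ = ((N / 2 : ℕ) : ℝ) * Real.log 4 := by rw [Real.log_pow]

/-- **Chebyshev's bound from the generating function, sharp at `N = 1`:**
`ψ(N) ≤ (N − 1) log 4` for every `N ≥ 1`. Strong induction on `N`:
`ψ(N) ≤ ψ(N − ⌊N/2⌋) + log C(N, ⌊N/2⌋) ≤ (N − ⌊N/2⌋ − 1) log 4 + ⌊N/2⌋ log 4`.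
[cite: Chebyshev1852, §§3–5 (the bound via binomial coefficients)] -/
theorem psi_le_pred_mul_log_four (N : ℕ) (hN : 1 ≤ N) :
    ψ (N : ℝ) ≤ ((N : ℝ) - 1) * Real.log 4 := by
  induction N using Nat.strong_induction_on with
  | _ N ih =>
    rcases Nat.lt_or_ge 1 N with hN2 | hN1
    swap
    · obtain rfl : N = 1 := le_antisymm hN1 hN
      simp [Chebyshev.psi_one]
    · -- `N ≥ 2`: split `N = a + b`, `a = ⌊N/2⌋ ≤ b = N − ⌊N/2⌋ < N`
      obtain ⟨b, hb⟩ : ∃ b, b = N - N / 2 := ⟨_, rfl⟩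
      have hab : N / 2 ≤ b := by omega
      have hN' : N / 2 + b = N := by omega
      have hb1 : 1 ≤ b := by omega
      have hbN : b < N := by omega
      have ih' := ih b hbN hb1
      have hstep := psi_add_sub_psi_le_log_choose hab
      rw [hN'] at hstep
      have hchoose := log_choose_half_le N
      have hcast : (b : ℝ) = (N : ℝ) - ((N / 2 : ℕ) : ℝ) := by
        have h := congrArg (Nat.cast (R := ℝ)) hN'
        push_cast at h
        linarith
      have ih'' : ψ (b : ℝ) ≤ ((N : ℝ) - ((N / 2 : ℕ) : ℝ) - 1) * Real.log 4 := by
        rw [← hcast]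
        exact ih'
      linarith [ih'', hstep, hchoose]

/-! ### The Helson potential: `Σ_{n ≤ N} Λ(n)/n ≤ log N + log 4 − 1` -/

/-- **Mertens' bound with the Chebyshev constant: `Σ_{n ≤ N} Λ(n)/n ≤ log N + log 4 − 1`** for
`N ≥ 1`. Proof: `N Σ_{k ≤ N} Λ(k)/k = Σ_k Λ(k) (⌊N/k⌋ + {N/k}) ≤ T(N) + (ψ(N) − log N)`, because
`{N/k} < 1` always and `{N/k} = 0` for the divisors `k ∣ N`, which carry `Σ_{k ∣ N} Λ(k) = log N`;
then `T(N) ≤ N log N − N + 1 + log N` and `ψ(N) ≤ (N − 1) log 4`.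
[cite: HardyWright2008, Thm 424 (§22.6), with the constant made explicit] -/
theorem sum_vonMangoldt_div_le {N : ℕ} (hN : 1 ≤ N) :
    ∑ n ∈ Icc 1 N, (Λ n : ℝ) / n ≤ Real.log N + (Real.log 4 - 1) := by
  have hN0 : (0 : ℝ) < N := by exact_mod_cast hN
  have hIcc : Icc 1 N = Ioc 0 N := by
    ext k
    simp only [mem_Icc, mem_Ioc]
    omega
  rw [hIcc]
  -- the termwise bound `N · Λ(k)/k ≤ Λ(k) ⌊N/k⌋ + Λ(k) − [k ∣ N] Λ(k)`
  have hpt : ∀ k ∈ Ioc 0 N, (N : ℝ) * ((Λ k : ℝ) / k) ≤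
      Λ k * ((N / k : ℕ) : ℝ) + Λ k - (if k ∣ N then Λ k else 0) := by
    intro k hk
    have hk0 : 0 < k := (mem_Ioc.1 hk).1
    have hk0' : (0 : ℝ) < k := by exact_mod_cast hk0
    have hΛ : 0 ≤ Λ k := vonMangoldt_nonneg
    have e : (N : ℝ) * ((Λ k : ℝ) / k) = Λ k * ((N : ℝ) / k) := by ring
    rw [e]
    split_ifs with hdvd
    · rw [← Nat.cast_div hdvd hk0'.ne']
      linarith
    · have hlt : (N : ℝ) / k < ((N / k : ℕ) : ℝ) + 1 := by
        have h := Nat.lt_floor_add_one ((N : ℝ) / k)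
        rwa [Nat.floor_div_eq_div] at h
      have h := mul_le_mul_of_nonneg_left hlt.le hΛ
      rw [mul_add, mul_one] at h
      linarith
  -- summing: `N Σ Λ(k)/k ≤ T(N) + ψ(N) − log N`
  have hsum : (N : ℝ) * ∑ k ∈ Ioc 0 N, (Λ k : ℝ) / k ≤
      Sylvester.T N + ψ (N : ℝ) - Real.log N := by
    rw [Finset.mul_sum, Sylvester.T_eq_sum, psi_natCast, ← vonMangoldt_sum (n := N)]
    have hdiv : ∑ i ∈ N.divisors, Λ i = ∑ k ∈ Ioc 0 N, (if k ∣ N then Λ k else 0) := by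
      rw [← Finset.sum_filter]
      refine Finset.sum_congr ?_ fun _ _ => rfl
      ext d
      simp only [Nat.mem_divisors, mem_filter, mem_Ioc]
      constructor
      · rintro ⟨hd, hN0'⟩
        exact ⟨⟨Nat.pos_of_dvd_of_pos hd (by omega), Nat.le_of_dvd (by omega) hd⟩, hd⟩
      · rintro ⟨⟨-, -⟩, hd⟩
        exact ⟨hd, by omega⟩
    rw [hdiv, ← Finset.sum_add_distrib, ← Finset.sum_sub_distrib]
    exact Finset.sum_le_sum hpt
  have hT := Sylvester.T_le hN
  have hψ := psi_le_pred_mul_log_four N hN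
  have hlog4 : 1 ≤ Real.log 4 := by
    rw [show (4 : ℝ) = 2 ^ 2 by norm_num, Real.log_pow]
    have := Real.log_two_gt_d9
    norm_num at this ⊢
    linarith
  have hkey : (N : ℝ) * ∑ k ∈ Ioc 0 N, (Λ k : ℝ) / k ≤
      (N : ℝ) * (Real.log N + (Real.log 4 - 1)) := by
    nlinarith [hsum, hT, hψ, hlog4]
  exact le_of_mul_le_mul_left hkey hN0

/-- The row sums of the Helson potential: for `1 ≤ m ≤ M`,
`log m + Σ_{n ≤ M/m} Λ(n)/n ≤ log m + log ⌊M/m⌋ + log 4 − 1 ≤ log M + 39/50`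
(`m ⌊M/m⌋ ≤ M`, `log 4 − 1 < 0.3863 < 39/50`). [folklore] -/
theorem log_add_sum_vonMangoldt_div_le {M m : ℕ} (hm : m ∈ Finset.Icc 1 M) :
    Real.log m + ∑ n ∈ Finset.Icc 1 (M / m), (Λ n : ℝ) / n ≤ Real.log M + 39 / 50 := by
  obtain ⟨hm1, hmM⟩ := Finset.mem_Icc.1 hm
  have hq1 : 1 ≤ M / m := Nat.div_pos hmM hm1
  have hS := sum_vonMangoldt_div_le hq1
  have hm0 : (0 : ℝ) < m := by exact_mod_cast hm1
  have hq0 : (0 : ℝ) < ((M / m : ℕ) : ℝ) := by exact_mod_cast hq1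
  have hprod : Real.log m + Real.log ((M / m : ℕ) : ℝ) ≤ Real.log M := by
    rw [← Real.log_mul hm0.ne' hq0.ne']
    refine Real.log_le_log (mul_pos hm0 hq0) ?_
    have h := Nat.div_mul_le_self M m
    calc (m : ℝ) * ((M / m : ℕ) : ℝ) = ((M / m * m : ℕ) : ℝ) := by push_cast; ring
      _ ≤ M := by exact_mod_cast h
  have hlog4 : Real.log 4 - 1 ≤ 39 / 50 := by
    rw [show (4 : ℝ) = 2 ^ 2 by norm_num, Real.log_pow]
    have := Real.log_two_lt_d9
    norm_num at this ⊢
    linarith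
  linarith

/-- **Stub S4 — the Helson potential with the sharpened prime-power constant.** For every `M` and
`a : ℕ → ℂ`: `Σ_{m ≤ M} ‖a_m‖² (log m + ψ₁(M/m)) ≤ (log M + 39/50) Σ_{m ≤ M} ‖a_m‖²`,
`ψ₁(y) = Σ_{n ≤ y} Λ(n)/n` — termwise from `log_add_sum_vonMangoldt_div_le`, i.e. from
`ψ₁(N) ≤ log N + log 4 − 1` (generating-function proof: `Λ * ζ = log` summed, Chebyshev's
`ψ(N) ≤ (N−1) log 4` by coefficient extraction from `log C(N, ⌊N/2⌋)`).
[cite: Chebyshev1852, §5; HardyWright2008, Thm 424] -/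
theorem stub_helsonG : ∀ (M : ℕ) (a : ℕ → ℂ),
    ∑ m ∈ Finset.Icc 1 M, ‖a m‖ ^ 2 *
        (Real.log m + ∑ n ∈ Finset.Icc 1 (M / m), (ArithmeticFunction.vonMangoldt n : ℝ) / n) ≤
      (Real.log M + 39 / 50) * ∑ m ∈ Finset.Icc 1 M, ‖a m‖ ^ 2 := by
  intro M a
  rw [Finset.mul_sum]
  refine Finset.sum_le_sum fun m hm => ?_
  rw [mul_comm (Real.log M + 39 / 50)]
  exact mul_le_mul_of_nonneg_left (log_add_sum_vonMangoldt_div_le hm) (by positivity)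

end Summit.RiemannHypothesis.RiemannHypothesis.Theorems.WeilCombHelsonGGenFun

end
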